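import Mathlib
import HarnessLib
import Summits.HubbardSuperconductivity.HubbardSuperconductivity.Theorems.KLProgrammeKLRegimeSplitTwoLegSizesMSChainFrames
import Summits.HubbardSuperconductivity.HubbardSuperconductivity.Theorems.KLProgrammeKLRegimeSplitTwoLegSizesMSOfProfileSplit
import Summits.HubbardSuperconductivity.HubbardSuperconductivity.Theorems.KLProgrammeKLRegimeSplitTwoLegPieceFnEval

/-!
# Route `KLProgramme`, crux K3 — gen-5 ENGINE child (stmt-…-19918, `stub_twoLeg_step`, clause `TwoLegSizesMST`), recipe (L)+(F):
# (E3a-MS) AT SCALE `n+1` FROM THE CHAIN PROFILES' ANGULAR SIZES — the packaging of (P4-a) + (P4-b)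

Seat hubbard-kl-k3c3-p1 (g3).  **`twoLegSizesMST_succ_of_chain_sizes`**: for a `TrigPolyC4v` frame `K` with piece decomposition
`K = Σ_{m ≤ nScales β} Kp m` (FrameOK (ii)'s shape), `μ ∈ klWindowC`, continuous local parts at scales `n`, `n+1`, an increment SYMBOL
`S : TrigPolyC4v` with `ν_{n+1}(K)(θ) − ν_n(K)(θ) = S(k_F^K(θ))` (k3c3-p3's `klLocalPart_sub_eq_evalM_comp`: `S = symInterp L Δσ_{n+1}`), `C⁴`
Fermi curves of the chain frames `msChain d Kp (n+1) N k` (P2-INTERFACE §1, size-keyed), centred angular sizes `Gs m j` of the chain profiles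
`msProfile μ S d Kp (n+1) N m` ((P4-c): the term table of MS-DESIGN-NOTE §3 via P2-INTERFACE §§2–4 and the Jackson bounds) and the two fits:
`TwoLegSizesMST L M G Q R β U μ K (n+1)`.  So after this file the (E3a-MS) supplier at scale `n+1` is EXACTLY: chain-curve regularity +
the angular term table + the fits.  Proofs only; nothing about the model.
-/

noncomputable section

namespace Summit.HubbardSuperconductivity.HubbardSuperconductivity.Theorems.KLRegimeSplit

set_option linter.dupNamespace false -- summit = problem name (single-conjunct summit), D-0017

open Real Finset Literature.MathematicalPhysics.QuantumLattice Literature.MathematicalPhysics.QuantumLattice.FermiRG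
open Summit.HubbardSuperconductivity.HubbardSuperconductivity.Theorems.KLProgrammeLegKernels

/-- **A symbol read along a `C⁴` Fermi curve is `C⁴`.** -/
theorem contDiff_curveProfile (μ : ℝ) (S C : TrigPolyC4v) (hC : ContDiff ℝ 4 (klFermiPoint μ C)) :
    ContDiff ℝ 4 (curveProfile μ S C) :=
  (TrigPolyC4v.contDiff_eval S).comp hC

/-- **The chain profiles are `C⁴`** when every chain frame has a `C⁴` Fermi curve. -/
theorem contDiff_msProfile (μ : ℝ) (S : TrigPolyC4v) (d : ℕ) (Kp : ℕ → TrigPolyC4v) (n N : ℕ)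
    (hC : ∀ k ≤ N - n, ContDiff ℝ 4 (klFermiPoint μ (msChain d Kp n N k))) (m : ℕ) :
    ContDiff ℝ 4 (msProfile μ S d Kp n N m) := by
  by_cases hm : m = n
  · subst hm
    have h : msProfile μ S d Kp m N m = curveProfile μ S (msChain d Kp m N 0) := by
      funext θ; simp [msProfile]
    rw [h]; exact contDiff_curveProfile μ S _ (hC 0 (Nat.zero_le _))
  · by_cases hm' : m ∈ Ioc n N
    · have hmn : n < m ∧ m ≤ N := Finset.mem_Ioc.mp hm'
      have h : msProfile μ S d Kp n N m = fun θ =>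
          curveProfile μ S (msChain d Kp n N (m - n)) θ - curveProfile μ S (msChain d Kp n N (m - n - 1)) θ := by
        funext θ; simp [msProfile, hm, hm']
      rw [h]
      exact (contDiff_curveProfile μ S _ (hC (m - n) (by omega))).sub (contDiff_curveProfile μ S _ (hC (m - n - 1) (by omega)))
    · rw [msProfile_of_not_mem hm hm']; exact contDiff_const

section MS

variable {L M : ℕ} [NeZero L] [NeZero M] {G : GeoConsts} {Q : EngConsts} {R : RenConsts} {β U μ : ℝ}

/-- **(E3a-MS) AT SCALE `n+1` FROM THE CHAIN PROFILES' ANGULAR SIZES.**  See the module docstring. -/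
theorem twoLegSizesMST_succ_of_chain_sizes (hμ : μ ∈ klWindowC) {K : TrigPolyC4v} {Kp : ℕ → TrigPolyC4v}
    (hK : ∀ p : Fin 2 → ℝ, K.eval p = ∑ m ∈ range (nScales β + 1), (Kp m).eval p) {n : ℕ} (hn : n + 1 ≤ nScales β) (d : ℕ)
    (hc₁ : Continuous (klLocalPart L M β U μ K (n + 1))) (hc₀ : Continuous (klLocalPart L M β U μ K n))
    {S : TrigPolyC4v} (hS : ∀ θ, klLocalPart L M β U μ K (n + 1) θ - klLocalPart L M β U μ K n θ = S.eval (klFermiPoint μ K θ))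
    (hC : ∀ k ≤ nScales β - (n + 1), ContDiff ℝ 4 (klFermiPoint μ (msChain d Kp (n + 1) (nScales β) k)))
    {X : ℝ} (hX : ∀ l ≤ 4, ∀ x : ℝ, ‖iteratedFDeriv ℝ l salmhoferCutoff x‖ ≤ X)
    (Gs : ℕ → ℕ → ℝ)
    (hGs : ∀ m, ∀ j ≤ 4, ∀ i ≤ j, ∀ t : ℝ,
      ‖iteratedFDeriv ℝ i (fun t => msProfile μ S d Kp (n + 1) (nScales β) m t -
        klAngularMean (msProfile μ S d Kp (n + 1) (nScales β) m)) t‖ ≤ Gs m j)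
    (hfit_n : ∀ j ≤ 4, (if j = 0 then |klAngularMean (msProfile μ S d Kp (n + 1) (nScales β) (n + 1))| else 0) +
      (j.factorial : ℝ) ^ 2 * (2 * j.factorial * X * 200 ^ j) * Gs (n + 1) j * (4 + max 1 (((j - 1).factorial : ℝ) / (8 / 5))) ^ j ≤
        twoLegBar G Q U j (n + 1))
    (hfit_m : ∀ m ∈ Ioc (n + 1) (nScales β), ∀ j ≤ 4,
      (if j = 0 then |klAngularMean (msProfile μ S d Kp (n + 1) (nScales β) m)| else 0) +
      (j.factorial : ℝ) ^ 2 * (2 * j.factorial * X * 200 ^ j) * Gs m j * (4 + max 1 (((j - 1).factorial : ℝ) / (8 / 5))) ^ j ≤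
        msBar G Q U (n + 1) * (R.Gfr j * uPow j U * (4 : ℝ) ^ (((j : ℤ) - 2) * m))) :
    TwoLegSizesMST L M G Q R β U μ K (n + 1) := by
  -- the piece is the G-extension of the increment profile, which is `S` read along the curve of `K`
  have hδ : (fun θ => klLocalPart L M β U μ K (n + 1) θ - klLocalPart L M β U μ K n θ) = curveProfile μ S K := by
    funext θ; rw [hS θ]; rfl
  have hP : klTwoLegPieceFn L M β U μ K.eval (n + 1) = klFrameExtFn μ (curveProfile μ S K) := by
    rw [klTwoLegPieceFn_eval_succ β U μ K n hc₁ hc₀, hδ]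
  exact twoLegSizesMST_of_profile_split hμ hP (msProfile μ S d Kp (n + 1) (nScales β))
    (fun θ => msProfile_split μ S d hK hn θ) (contDiff_msProfile μ S d Kp (n + 1) (nScales β) hC)
    (msProfile_periodic μ S d Kp (n + 1) (nScales β)) (msProfile_even μ S d Kp (n + 1) (nScales β))
    (msProfile_diag μ S d Kp (n + 1) (nScales β)) hX Gs hGs hfit_n hfit_m

end MS

end Summit.HubbardSuperconductivity.HubbardSuperconductivity.Theorems.KLRegimeSplit

end
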